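import Mathlib
import Literature.NumberTheory.LFunctions.Zhang2022.Section15CVarpiMult
import HarnessLib

/-!
# Zhang (2022), Lemma 15.3 / App. A u031 (repaired normaliser): scalar estimates for the value of the
# Euler factor at `s = 1` — `q^{β} = 1 + O(|β| log q)` and the Möbius-type step — kernel-checked

Topic `Literature/NumberTheory/LFunctions/Zhang2022` (Landau–Siegel audit tree; verdict-neutral).
Y. Zhang, *Discrete mean estimates and the Landau–Siegel zero*, arXiv:2211.02515v1 (2022)
[Zhang2022LandauSiegel] — **an unrefereed manuscript under adjudication; nothing in this file asserts
or denies its Theorems 1–2.** ZHANG-L discharge lane (WP15), the SCALAR block of the per-prime value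
hypothesis `hval` of `step15_u053R_of_local` (leaf `Typed.Section15C.Lemma153RpI`, App. A p. 105
tex L5178: "`𝔲₁ⱼ(q,1) = (1−q⁻²)²(1−χ(q)q⁻²)⁻¹ + O(α₁ log q / q)` if `(q,D) = 1`"): the only analysis in
that claim is that replacing `1 − βⱼ` by `1` in a power `q^{−k(1−βⱼ)}` costs `O(|βⱼ| log q · q^{−k})`,
and `|βⱼ| log q ≤ 5α𝓛 → 0` for `q ≤ D`. Elementary statements, for the assembler of `hval` to import:

* `norm_natCast_cpow_sub_one_le` — `‖q^z − 1‖ ≤ 2‖z‖ log q` for `‖z‖ log q ≤ 1`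
  (`Complex.norm_exp_sub_one_le`);
* `norm_natCast_cpow_add_sub_le` — `‖q^{a+β} − q^a‖ ≤ 2‖β‖ log q · ‖q^a‖`; the instances
  `norm_natCast_cpow_neg_one_sub_sub_le` (`a = −k`, shift `kβ`: `‖q^{−k(1−β)} − q^{−k}‖ ≤ 2k‖β‖log q·q^{−k}`)
  and `norm_natCast_cpow_le_of_small` (`‖q^{β}‖ ≤ 3`);
* `norm_inv_one_sub_sub_le` — `‖(1−A)⁻¹ − (1−B)⁻¹‖ ≤ 16‖A − B‖` for `‖A‖, ‖B‖ ≤ 3/4`, and the Möbius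
  step `norm_moebius_step_le`: `‖(1 − v q^{−2(1−β)})⁻¹ − (1 − v q^{−2})⁻¹‖ ≤ 64‖β‖ log q / q²`
  (`‖v‖ ≤ 1`, `q ≥ 2`, `2‖β‖ log q ≤ 1`);
* `natCast_cpow_neg_natCast`, `norm_natCast_cpow_neg_natCast` — `q^{−k} = 1/q^k` as complex powers;
* `betaJ_log_small` — for all large `D`: `4‖βⱼ‖ log q ≤ 1` and `‖βⱼ‖ < 5α` for every `j` and `q ≤ D`.

No new definitions; no named facts.

## References

* Y. Zhang, arXiv:2211.02515v1 (2022), App. A p. 105 (tex L5176–L5178); §15 Lemma 15.3 p. 87;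
  §2 (2.13). [cite: Zhang2022LandauSiegel, App. A p. 105]
-/

noncomputable section

open Complex Real

namespace Literature.NumberTheory.LFunctions.Zhang2022.Typed.Section15C

open Literature.NumberTheory.LFunctions.Zhang2022
open Literature.NumberTheory.LFunctions.Zhang2022.Skeleton

/-! ## `q^z − 1 = O(|z| log q)` -/

/-- `log q` (complex) is the real logarithm (elementary step of the `q^{β}`-expansion).
[cite: Zhang2022LandauSiegel, App. A p. 105] -/
theorem log_natCast_eq (q : ℕ) : Complex.log (q : ℂ) = (Real.log q : ℂ) := by
  rw [← Complex.ofReal_natCast, ← Complex.ofReal_log (Nat.cast_nonneg q)]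

/-- **`‖q^z − 1‖ ≤ 2‖z‖·log q`** for `q ≥ 1` and `‖z‖·log q ≤ 1` (`q^z = e^{z log q}`,
`|e^w − 1| ≤ 2|w|` for `|w| ≤ 1`). [cite: Zhang2022LandauSiegel, App. A p. 105] -/
theorem norm_natCast_cpow_sub_one_le {q : ℕ} (hq : 0 < q) {z : ℂ} (hz : ‖z‖ * Real.log q ≤ 1) :
    ‖(q : ℂ) ^ z - 1‖ ≤ 2 * ‖z‖ * Real.log q := by
  have hq0 : (q : ℂ) ≠ 0 := by exact_mod_cast hq.ne'
  have hlog0 : 0 ≤ Real.log q := Real.log_natCast_nonneg q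
  have hn : ‖Complex.log q * z‖ = ‖z‖ * Real.log q := by
    rw [norm_mul, log_natCast_eq, Complex.norm_real, Real.norm_of_nonneg hlog0, mul_comm]
  rw [Complex.cpow_def_of_ne_zero hq0]
  calc ‖Complex.exp (Complex.log q * z) - 1‖ ≤ 2 * ‖Complex.log q * z‖ :=
        Complex.norm_exp_sub_one_le (by rw [hn]; exact hz)
    _ = 2 * ‖z‖ * Real.log q := by rw [hn]; ring

/-- **`‖q^{a+β} − q^a‖ ≤ 2‖β‖·log q·‖q^a‖`** for `‖β‖·log q ≤ 1`. [cite: Zhang2022LandauSiegel, App. A p. 105] -/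
theorem norm_natCast_cpow_add_sub_le {q : ℕ} (hq : 0 < q) (a : ℂ) {β : ℂ}
    (hβ : ‖β‖ * Real.log q ≤ 1) :
    ‖(q : ℂ) ^ (a + β) - (q : ℂ) ^ a‖ ≤ 2 * ‖β‖ * Real.log q * ‖(q : ℂ) ^ a‖ := by
  have hq0 : (q : ℂ) ≠ 0 := by exact_mod_cast hq.ne'
  rw [Complex.cpow_add _ _ hq0, ← mul_sub_one, norm_mul]
  calc ‖(q : ℂ) ^ a‖ * ‖(q : ℂ) ^ β - 1‖ ≤ ‖(q : ℂ) ^ a‖ * (2 * ‖β‖ * Real.log q) :=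
        mul_le_mul_of_nonneg_left (norm_natCast_cpow_sub_one_le hq hβ) (norm_nonneg _)
    _ = 2 * ‖β‖ * Real.log q * ‖(q : ℂ) ^ a‖ := by ring

/-- **`‖q^β‖ ≤ 3`** for `‖β‖·log q ≤ 1`. [cite: Zhang2022LandauSiegel, App. A p. 105] -/
theorem norm_natCast_cpow_le_of_small {q : ℕ} (hq : 0 < q) {β : ℂ} (hβ : ‖β‖ * Real.log q ≤ 1) :
    ‖(q : ℂ) ^ β‖ ≤ 3 := by
  have h := norm_natCast_cpow_sub_one_le hq hβ
  have hβ0 : 0 ≤ ‖β‖ * Real.log q := mul_nonneg (norm_nonneg _) (Real.log_natCast_nonneg q)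
  calc ‖(q : ℂ) ^ β‖ = ‖((q : ℂ) ^ β - 1) + 1‖ := by rw [sub_add_cancel]
    _ ≤ ‖(q : ℂ) ^ β - 1‖ + ‖(1 : ℂ)‖ := norm_add_le _ _
    _ ≤ 2 * ‖β‖ * Real.log q + 1 := by rw [norm_one]; linarith
    _ ≤ 3 := by nlinarith

/-- `q^{−k} = 1/q^k` as a complex power (`k ∈ ℕ`; the value `x = q^{−1}` at `s = 1`).
[cite: Zhang2022LandauSiegel, App. A p. 105] -/
theorem natCast_cpow_neg_natCast (q k : ℕ) : (q : ℂ) ^ (-(k : ℂ)) = 1 / (q : ℂ) ^ k := by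
  rw [Complex.cpow_neg, Complex.cpow_natCast, one_div]

/-- `‖q^{−k}‖ = q^{−k}` (real power) for `q ≥ 1` (elementary step).
[cite: Zhang2022LandauSiegel, App. A p. 105] -/
theorem norm_natCast_cpow_neg_natCast {q : ℕ} (hq : 0 < q) (k : ℕ) :
    ‖(q : ℂ) ^ (-(k : ℂ))‖ = (q : ℝ) ^ (-(k : ℝ)) := by
  rw [Complex.norm_natCast_cpow_of_pos hq]; simp

/-- **`‖q^{−k(1−β)} − q^{−k}‖ ≤ 2k‖β‖·log q·q^{−k}`** for `k‖β‖·log q ≤ 1` (`k ∈ ℕ`): the cost of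
replacing `1 − βⱼ` by `1` in the `k`-th power. [cite: Zhang2022LandauSiegel, App. A p. 105] -/
theorem norm_natCast_cpow_neg_one_sub_sub_le {q : ℕ} (hq : 0 < q) (k : ℕ) {β : ℂ}
    (hβ : (k : ℝ) * ‖β‖ * Real.log q ≤ 1) :
    ‖(q : ℂ) ^ (-((k : ℂ) * (1 - β))) - (q : ℂ) ^ (-(k : ℂ))‖ ≤
      2 * k * ‖β‖ * Real.log q * (q : ℝ) ^ (-(k : ℝ)) := by
  have hkβ : ‖(k : ℂ) * β‖ * Real.log q ≤ 1 := by rwa [norm_mul, Complex.norm_natCast]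
  have h := norm_natCast_cpow_add_sub_le hq (-(k : ℂ)) hkβ
  rw [show -((k : ℂ) * (1 - β)) = -(k : ℂ) + (k : ℂ) * β by ring]
  calc ‖(q : ℂ) ^ (-(k : ℂ) + (k : ℂ) * β) - (q : ℂ) ^ (-(k : ℂ))‖
      ≤ 2 * ‖(k : ℂ) * β‖ * Real.log q * ‖(q : ℂ) ^ (-(k : ℂ))‖ := h
    _ = 2 * k * ‖β‖ * Real.log q * (q : ℝ) ^ (-(k : ℝ)) := by
        rw [norm_mul, Complex.norm_natCast, norm_natCast_cpow_neg_natCast hq]; ring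

/-! ## The Möbius-type step `(1 − A)⁻¹ − (1 − B)⁻¹` -/

/-- **`‖(1−A)⁻¹ − (1−B)⁻¹‖ ≤ 16‖A − B‖`** for `‖A‖, ‖B‖ ≤ 3/4` (`= (A−B)/((1−A)(1−B))`,
`|1−A|, |1−B| ≥ 1/4`). [cite: Zhang2022LandauSiegel, App. A p. 105] -/
theorem norm_inv_one_sub_sub_le {A B : ℂ} (hA : ‖A‖ ≤ 3 / 4) (hB : ‖B‖ ≤ 3 / 4) :
    ‖(1 - A)⁻¹ - (1 - B)⁻¹‖ ≤ 16 * ‖A - B‖ := by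
  have h1A : 1 / 4 ≤ ‖1 - A‖ := by
    have := norm_sub_norm_le (1 : ℂ) A; rw [norm_one] at this; linarith
  have h1B : 1 / 4 ≤ ‖1 - B‖ := by
    have := norm_sub_norm_le (1 : ℂ) B; rw [norm_one] at this; linarith
  have hA0 : (1 : ℂ) - A ≠ 0 := fun h => by rw [h, norm_zero] at h1A; linarith
  have hB0 : (1 : ℂ) - B ≠ 0 := fun h => by rw [h, norm_zero] at h1B; linarith
  have heq : (1 - A)⁻¹ - (1 - B)⁻¹ = (A - B) / ((1 - A) * (1 - B)) := by
    field_simp; ring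
  rw [heq, norm_div, norm_mul, div_le_iff₀ (by positivity)]
  have hAB : 0 ≤ ‖A - B‖ := norm_nonneg _
  nlinarith [mul_le_mul h1A h1B (by norm_num) (norm_nonneg _)]

/-- **The Möbius step**: for `‖v‖ ≤ 1`, `q ≥ 2` and `2‖β‖·log q ≤ 1`,
`‖(1 − v·q^{−2(1−β)})⁻¹ − (1 − v·q^{−2})⁻¹‖ ≤ 64‖β‖·log q / q²`
(`‖v q^{−2}‖ ≤ 1/4`, `‖q^{2β}‖ ≤ 3`, `‖q^{−2(1−β)} − q^{−2}‖ ≤ 4‖β‖ log q/q²`).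
[cite: Zhang2022LandauSiegel, App. A p. 105] -/
theorem norm_moebius_step_le {q : ℕ} (hq : 2 ≤ q) {v β : ℂ} (hv : ‖v‖ ≤ 1)
    (hβ : 2 * ‖β‖ * Real.log q ≤ 1) :
    ‖(1 - v * (q : ℂ) ^ (-((2 : ℂ) * (1 - β))))⁻¹ - (1 - v * (q : ℂ) ^ (-(2 : ℂ)))⁻¹‖ ≤
      64 * ‖β‖ * Real.log q / (q : ℝ) ^ 2 := by
  have hq0 : 0 < q := by omega
  have hqC : (q : ℂ) ≠ 0 := by exact_mod_cast hq0.ne'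
  have hq2 : (2 : ℝ) ≤ q := by exact_mod_cast hq
  have hqsq : (4 : ℝ) ≤ (q : ℝ) ^ 2 := by nlinarith
  have hqsq0 : (0 : ℝ) < (q : ℝ) ^ 2 := by positivity
  -- `q^{−2}` and `q^{−2(1−β)} = q^{−2}·q^{2β}`
  have h2 : (q : ℂ) ^ (-(2 : ℂ)) = 1 / (q : ℂ) ^ 2 := by exact_mod_cast natCast_cpow_neg_natCast q 2
  have hn2 : ‖(q : ℂ) ^ (-(2 : ℂ))‖ = 1 / (q : ℝ) ^ 2 := by
    rw [h2, norm_div, norm_one, norm_pow, Complex.norm_natCast]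
  have hsplit : (q : ℂ) ^ (-((2 : ℂ) * (1 - β))) = (q : ℂ) ^ (-(2 : ℂ)) * (q : ℂ) ^ ((2 : ℂ) * β) := by
    rw [← Complex.cpow_add _ _ hqC]; congr 1; ring
  have h2β : ‖(2 : ℂ) * β‖ * Real.log q ≤ 1 := by
    rw [norm_mul, Complex.norm_two]; exact hβ
  have hpow3 : ‖(q : ℂ) ^ ((2 : ℂ) * β)‖ ≤ 3 := norm_natCast_cpow_le_of_small hq0 h2β
  have hsub : ‖(q : ℂ) ^ ((2 : ℂ) * β) - 1‖ ≤ 2 * ‖(2 : ℂ) * β‖ * Real.log q :=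
    norm_natCast_cpow_sub_one_le hq0 h2β
  rw [norm_mul, Complex.norm_two] at hsub
  -- sizes of `A = v q^{−2(1−β)}` and `B = v q^{−2}`
  have hB : ‖v * (q : ℂ) ^ (-(2 : ℂ))‖ ≤ 3 / 4 := by
    rw [norm_mul, hn2]
    calc ‖v‖ * (1 / (q : ℝ) ^ 2) ≤ 1 * (1 / 4) := by
          gcongr
      _ ≤ 3 / 4 := by norm_num
  have hA : ‖v * (q : ℂ) ^ (-((2 : ℂ) * (1 - β)))‖ ≤ 3 / 4 := by
    rw [hsplit, norm_mul, norm_mul, hn2]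
    calc ‖v‖ * (1 / (q : ℝ) ^ 2 * ‖(q : ℂ) ^ ((2 : ℂ) * β)‖) ≤ 1 * (1 / 4 * 3) := by
          gcongr
      _ = 3 / 4 := by norm_num
  have hdiff : ‖v * (q : ℂ) ^ (-((2 : ℂ) * (1 - β))) - v * (q : ℂ) ^ (-(2 : ℂ))‖ ≤
      4 * ‖β‖ * Real.log q / (q : ℝ) ^ 2 := by
    rw [hsplit, ← mul_assoc, ← mul_sub_one, norm_mul, norm_mul, hn2]
    have hlog0 : 0 ≤ Real.log q := Real.log_natCast_nonneg q
    calc ‖v‖ * (1 / (q : ℝ) ^ 2) * ‖(q : ℂ) ^ ((2 : ℂ) * β) - 1‖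
        ≤ 1 * (1 / (q : ℝ) ^ 2) * (2 * (2 * ‖β‖) * Real.log q) := by
          gcongr
      _ = 4 * ‖β‖ * Real.log q / (q : ℝ) ^ 2 := by field_simp; ring
  calc ‖(1 - v * (q : ℂ) ^ (-((2 : ℂ) * (1 - β))))⁻¹ - (1 - v * (q : ℂ) ^ (-(2 : ℂ)))⁻¹‖
      ≤ 16 * ‖v * (q : ℂ) ^ (-((2 : ℂ) * (1 - β))) - v * (q : ℂ) ^ (-(2 : ℂ))‖ :=
        norm_inv_one_sub_sub_le hA hB
    _ ≤ 16 * (4 * ‖β‖ * Real.log q / (q : ℝ) ^ 2) := by gcongr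
    _ = 64 * ‖β‖ * Real.log q / (q : ℝ) ^ 2 := by ring

/-! ## `|βⱼ| log q → 0` for `q ≤ D` -/

/-- **For all large `D`: `4‖βⱼ‖·log q ≤ 1` and `‖βⱼ‖ < 5α`** for every `j` and every `q ≤ D`
(`‖βⱼ‖ < 5α` once `15|c′|α𝓛 < 2`, `Lemma153Rp.norm_betaJ_lt`; `log q ≤ 𝓛`; `20α𝓛 ≤ 20/21`).
[cite: Zhang2022LandauSiegel, §2 (2.13); App. A p. 105] -/
theorem betaJ_log_small (c' : ℝ) : ForAllLarge fun D _ _ => ∀ j : ℕ, ∀ q : ℕ, (q : ℝ) ≤ D →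
    4 * ‖betaJ c' D j‖ * Real.log q ≤ 1 ∧ ‖betaJ c' D j‖ < 5 * alpha D := by
  set ε : ℝ := 1 / (21 + 15 * |c'|) with hε
  have hεpos : 0 < ε := by rw [hε]; positivity
  refine ⟨max 3 (⌈Real.exp (Real.pi / ε + 1)⌉₊ + 1), fun D _ χ hD _ _ j q hqD => ?_⟩
  have hD3 : 3 ≤ D := le_trans (le_max_left _ _) hD
  have hαℓ : alpha D * ell D ≤ ε := Lemma153Rp.alpha_mul_ell_le_of_le hεpos (le_trans (le_max_right _ _) hD)
  have hα : 0 < alpha D := alpha_pos hD3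
  have hℓ1 : 1 < ell D := one_lt_ell hD3
  have hαℓ0 : 0 ≤ alpha D * ell D := by positivity
  have hc0 : 0 ≤ |c'| := abs_nonneg _
  have hK : 0 < 21 + 15 * |c'| := by positivity
  have hεK : ε * (21 + 15 * |c'|) = 1 := by rw [hε]; field_simp
  have hsmall : 15 * |c'| * (alpha D * ell D) < 2 := by
    calc 15 * |c'| * (alpha D * ell D) ≤ 15 * |c'| * ε := by gcongr
      _ < 2 := by nlinarith
  have hβ : ‖betaJ c' D j‖ < 5 * alpha D := Lemma153Rp.norm_betaJ_lt c' hD3 hsmall j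
  refine ⟨?_, hβ⟩
  -- `log q ≤ 𝓛`
  have hlogq : Real.log q ≤ ell D := by
    rcases Nat.eq_zero_or_pos q with h0 | hpos
    · rw [h0, Nat.cast_zero, Real.log_zero]; linarith
    · rw [ell]; exact Real.log_le_log (by exact_mod_cast hpos) hqD
  have hlog0 : 0 ≤ Real.log q := Real.log_natCast_nonneg q
  calc 4 * ‖betaJ c' D j‖ * Real.log q ≤ 4 * (5 * alpha D) * ell D := by gcongr
    _ = 20 * (alpha D * ell D) := by ring
    _ ≤ 20 * ε := by gcongr
    _ ≤ 1 := by nlinarith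

end Literature.NumberTheory.LFunctions.Zhang2022.Typed.Section15C
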